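import Mathlib
import HarnessLib
import Summits.KontsevichZagierPeriods.Zeta5Search.Denom.TwoTaleP15SavingAPI

/-!
# TwoTaleP15Levels — from per-interval prime divisibilities to `Φ̃ₙ ∣ ·` and to `Inclusion`

HONEST FRAMING: systematic search; no irrationality claim unless certified.

fam-denom (pub-zeta5), FAMILY.md §6 D16, file 22.  The saving product `Φ̃ₙ = TwoTaleP15Saving.savingProduct n` counts a
prime `p` (`26n < p² `, `p ≤ 15n`) once for every interval `ivl i`, `i < 20`, containing `{n/p}`; the intervals
`ivl 0 … ivl 8` are the LEVEL-1 components of `{φ̃ ≥ 1}` and `ivl 9 … ivl 19` the LEVEL-2 components of `{φ̃ = 2}`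
(each nested in a level-1 one).  Arithmetic proofs (Zudilin's Lemma 7 digit rule for `φ`, the second tale for `φ̂`)
naturally deliver, interval by interval, `p ∣ M` on a level-1 interval and `p² ∣ M` on a level-2 interval.  This file
turns such a family of statements into `Φ̃ₙ ∣ M` (all PROVED, no inputs):

* `lvl1_unique`, `lvl2_unique` — the level-1 (resp. level-2) intervals are pairwise disjoint (rational endpoints,
  `linarith`), hence `ivlMult n p ≤ 2` (`ivlMult_le_two`);
* **`prime_pow_ivlMult_dvd_of_levels`**: level-1 divisibilities `p ∣ M` and level-2 divisibilities `p² ∣ M` give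
  `p ^ ivlMult n p ∣ M` for every `p`, hence **`savingProduct_dvd_of_levels : Φ̃ₙ ∣ M`**;
* **`inclusion_of_levels`**: the same hypotheses for `M = formQ n` and for an integer `Z` with `D₁₆ₙD₁₅ₙ·formP n = Z`
  (all `n ≥ 1`) prove `TwoTaleP15Forms.Inclusion`;
* `hyps_of_mem_classPrimes_ivl` unpacks membership into the hypotheses used by per-interval theorems
  (`p.Prime`, `26 * n < p ^ 2` in `ℕ`, `uᵢ ≤ Int.fract (n/p) < vᵢ`).
-/

noncomputable section

open Finset
open Literature.NumberTheory.DiophantineApproximation.RhinViola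
open Summit.KontsevichZagierPeriods.Zeta5Search.Denom.TwoTaleP15Saving
open Summit.KontsevichZagierPeriods.Zeta5Search.Denom.TwoTaleP15Forms
open Summit.KontsevichZagierPeriods.Zeta5Search.Denom.TwoTaleP15SavingAPI

namespace Summit.KontsevichZagierPeriods.Zeta5Search.Denom.TwoTaleP15Levels

/-! ### Unpacking membership -/

/-- `26n < p²` over `ℝ` iff over `ℕ`. -/
theorem cast_lt_sq_iff {n p : ℕ} : (26 : ℝ) * n < (p : ℝ) ^ 2 ↔ 26 * n < p ^ 2 := by
  constructor
  · intro h; exact_mod_cast h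
  · intro h; exact_mod_cast h

/-- A counted prime satisfies the hypotheses of the per-interval divisibility theorems. -/
theorem hyps_of_mem_classPrimes_ivl {i n p : ℕ} (h : p ∈ classPrimes 26 primeCut (ivl i) n) :
    p.Prime ∧ 26 * n < p ^ 2 ∧ (ivl i).1 ≤ Int.fract ((n : ℝ) / p) ∧ Int.fract ((n : ℝ) / p) < (ivl i).2 := by
  obtain ⟨hp, -, h2, h3, h4⟩ := mem_classPrimes_ivl_iff.1 h
  exact ⟨hp, cast_lt_sq_iff.1 h2, h3, h4⟩

/-! ### The intervals of one level are pairwise disjoint -/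

/-- Ordered separation of the level-1 intervals: `vᵢ ≤ uⱼ` for `i < j < 9`. -/
theorem lvl1_sep {i j : ℕ} (hij : i < j) (hj : j < 9) : (ivl i).2 ≤ (ivl j).1 := by
  interval_cases j <;> interval_cases i <;> norm_num [ivl]

/-- Ordered separation of the level-2 intervals: `vᵢ ≤ uⱼ` for `9 ≤ i < j < 20`. -/
theorem lvl2_sep {i j : ℕ} (hi : 9 ≤ i) (hij : i < j) (hj : j < 20) : (ivl i).2 ≤ (ivl j).1 := by
  interval_cases j <;> interval_cases i <;> norm_num [ivl]

/-- The nine level-1 intervals `ivl 0, …, ivl 8` are pairwise disjoint. -/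
theorem lvl1_unique {x : ℝ} {i j : ℕ} (hi : i < 9) (hj : j < 9)
    (h1 : (ivl i).1 ≤ x) (h2 : x < (ivl i).2) (h3 : (ivl j).1 ≤ x) (h4 : x < (ivl j).2) : i = j := by
  by_contra hne
  rcases Nat.lt_or_gt_of_ne hne with h | h
  · have := lvl1_sep h hj; linarith
  · have := lvl1_sep h hi; linarith

/-- The eleven level-2 intervals `ivl 9, …, ivl 19` are pairwise disjoint. -/
theorem lvl2_unique {x : ℝ} {i j : ℕ} (hi : 9 ≤ i) (hi' : i < 20) (hj : 9 ≤ j) (hj' : j < 20)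
    (h1 : (ivl i).1 ≤ x) (h2 : x < (ivl i).2) (h3 : (ivl j).1 ≤ x) (h4 : x < (ivl j).2) : i = j := by
  by_contra hne
  rcases Nat.lt_or_gt_of_ne hne with h | h
  · have := lvl2_sep hi h hj'; linarith
  · have := lvl2_sep hj h hi'; linarith

/-- At most one level-1 interval counts a given `p`. -/
theorem card_filter_lvl1_le_one (n p : ℕ) :
    ((Ico 0 9).filter fun i => p ∈ classPrimes 26 primeCut (ivl i) n).card ≤ 1 := by
  refine card_le_one.2 fun i hi j hj => ?_
  simp only [mem_filter, mem_Ico] at hi hj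
  obtain ⟨-, -, a1, a2⟩ := hyps_of_mem_classPrimes_ivl hi.2
  obtain ⟨-, -, b1, b2⟩ := hyps_of_mem_classPrimes_ivl hj.2
  exact lvl1_unique hi.1.2 hj.1.2 a1 a2 b1 b2

/-- At most one level-2 interval counts a given `p`. -/
theorem card_filter_lvl2_le_one (n p : ℕ) :
    ((Ico 9 20).filter fun i => p ∈ classPrimes 26 primeCut (ivl i) n).card ≤ 1 := by
  refine card_le_one.2 fun i hi j hj => ?_
  simp only [mem_filter, mem_Ico] at hi hj
  obtain ⟨-, -, a1, a2⟩ := hyps_of_mem_classPrimes_ivl hi.2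
  obtain ⟨-, -, b1, b2⟩ := hyps_of_mem_classPrimes_ivl hj.2
  exact lvl2_unique hi.1.1 hi.1.2 hj.1.1 hj.1.2 a1 a2 b1 b2

/-- `ivlMult` splits into its level-1 and level-2 counts. -/
theorem ivlMult_eq_add (n p : ℕ) :
    ivlMult n p = ((Ico 0 9).filter fun i => p ∈ classPrimes 26 primeCut (ivl i) n).card +
      ((Ico 9 20).filter fun i => p ∈ classPrimes 26 primeCut (ivl i) n).card := by
  have h : range 20 = Ico 0 9 ∪ Ico 9 20 := by
    rw [range_eq_Ico, Ico_union_Ico_eq_Ico (by norm_num) (by norm_num)]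
  unfold ivlMult
  rw [h, filter_union, card_union_of_disjoint]
  exact disjoint_filter_filter (Ico_disjoint_Ico_consecutive 0 9 20)

/-- `φ̃ ≤ 2`: every prime is counted at most twice. -/
theorem ivlMult_le_two (n p : ℕ) : ivlMult n p ≤ 2 := by
  rw [ivlMult_eq_add]
  have := card_filter_lvl1_le_one n p
  have := card_filter_lvl2_le_one n p
  omega

/-! ### From level divisibilities to `Φ̃ₙ ∣ M` -/

/-- **Level divisibilities give `p ^ ivlMult n p ∣ M`.**  If `p ∣ M` whenever `p` is counted in a level-1 interval and
`p² ∣ M` whenever `p` is counted in a level-2 interval, then `p ^ ivlMult n p ∣ M` (for every `p`; no primality needed). -/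
theorem prime_pow_ivlMult_dvd_of_levels {n : ℕ} {M : ℤ}
    (h1 : ∀ i < 9, ∀ p ∈ classPrimes 26 primeCut (ivl i) n, (p : ℤ) ∣ M)
    (h2 : ∀ i, 9 ≤ i → i < 20 → ∀ p ∈ classPrimes 26 primeCut (ivl i) n, (p : ℤ) ^ 2 ∣ M)
    (p : ℕ) : (p : ℤ) ^ ivlMult n p ∣ M := by
  have c1 := card_filter_lvl1_le_one n p
  rw [ivlMult_eq_add]
  rcases ((Ico 9 20).filter fun i => p ∈ classPrimes 26 primeCut (ivl i) n).eq_empty_or_nonempty with hS | ⟨i, hi⟩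
  · rw [hS, card_empty, add_zero]
    rcases ((Ico 0 9).filter fun i => p ∈ classPrimes 26 primeCut (ivl i) n).eq_empty_or_nonempty
      with hT | ⟨j, hj⟩
    · rw [hT, card_empty, pow_zero]; exact one_dvd _
    · rw [le_antisymm c1 (card_pos.2 ⟨j, hj⟩), pow_one]
      simp only [mem_filter, mem_Ico] at hj
      exact h1 j hj.1.2 p hj.2
  · have hp2 : (p : ℤ) ^ 2 ∣ M := by
      simp only [mem_filter, mem_Ico] at hi
      exact h2 i hi.1.1 hi.1.2 p hi.2
    refine (pow_dvd_pow _ ?_).trans hp2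
    have := ivlMult_le_two n p
    rw [ivlMult_eq_add] at this
    exact this

/-- **`Φ̃ₙ ∣ M` from level divisibilities.** -/
theorem savingProduct_dvd_of_levels {n : ℕ} {M : ℤ}
    (h1 : ∀ i < 9, ∀ p ∈ classPrimes 26 primeCut (ivl i) n, (p : ℤ) ∣ M)
    (h2 : ∀ i, 9 ≤ i → i < 20 → ∀ p ∈ classPrimes 26 primeCut (ivl i) n, (p : ℤ) ^ 2 ∣ M) :
    (savingProduct n : ℤ) ∣ M :=
  savingProduct_dvd_int_of_prime_pow_dvd fun p _ => prime_pow_ivlMult_dvd_of_levels h1 h2 p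

/-! ### The `Inclusion` input from per-interval theorems -/

/-- **`Inclusion` from level divisibilities of `qₙ` and of `D₁₆ₙD₁₅ₙ pₙ`.**  For every `n ≥ 1`: `p ∣ qₙ` (level 1) and
`p² ∣ qₙ` (level 2) for the counted primes, and an integer `Z = D₁₆ₙD₁₅ₙ pₙ` with the same divisibilities, prove
`TwoTaleP15Forms.Inclusion` (`Φ̃ₙ ∣ D₁₆ₙD₁₅ₙ qₙ` and `Φ̃ₙ⁻¹ D₁₆ₙD₁₅ₙ pₙ ∈ ℤ`). -/
theorem inclusion_of_levels
    (hq1 : ∀ n, 1 ≤ n → ∀ i < 9, ∀ p ∈ classPrimes 26 primeCut (ivl i) n, (p : ℤ) ∣ formQ n)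
    (hq2 : ∀ n, 1 ≤ n → ∀ i, 9 ≤ i → i < 20 → ∀ p ∈ classPrimes 26 primeCut (ivl i) n, (p : ℤ) ^ 2 ∣ formQ n)
    (hp : ∀ n, 1 ≤ n → ∃ Z : ℤ, ((lcmNormaliser n : ℕ) : ℚ) * formP n = Z ∧
      (∀ i < 9, ∀ p ∈ classPrimes 26 primeCut (ivl i) n, (p : ℤ) ∣ Z) ∧
      (∀ i, 9 ≤ i → i < 20 → ∀ p ∈ classPrimes 26 primeCut (ivl i) n, (p : ℤ) ^ 2 ∣ Z)) :
    Inclusion := by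
  refine inclusion_of_dvd (fun n hn p _ => ?_) fun n hn => ?_
  · exact (prime_pow_ivlMult_dvd_of_levels (hq1 n hn) (hq2 n hn) p).trans (dvd_mul_left _ _)
  · obtain ⟨Z, hZ, hz1, hz2⟩ := hp n hn
    obtain ⟨A, hA⟩ := savingProduct_dvd_of_levels hz1 hz2
    exact ⟨A, by rw [hZ, hA]; push_cast; ring⟩

/-- Variant with the level divisibilities stated through the unpacked hypotheses (`p` prime, `26n < p²`,
`uᵢ ≤ {n/p} < vᵢ`), the shape in which per-interval theorems are proved. -/
theorem savingProduct_dvd_of_unpacked {n : ℕ} {M : ℤ}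
    (h1 : ∀ i < 9, ∀ p : ℕ, p.Prime → 26 * n < p ^ 2 →
      (ivl i).1 ≤ Int.fract ((n : ℝ) / p) → Int.fract ((n : ℝ) / p) < (ivl i).2 → (p : ℤ) ∣ M)
    (h2 : ∀ i, 9 ≤ i → i < 20 → ∀ p : ℕ, p.Prime → 26 * n < p ^ 2 →
      (ivl i).1 ≤ Int.fract ((n : ℝ) / p) → Int.fract ((n : ℝ) / p) < (ivl i).2 → (p : ℤ) ^ 2 ∣ M) :
    (savingProduct n : ℤ) ∣ M := by
  refine savingProduct_dvd_of_levels (fun i hi p hp => ?_) fun i hi hi' p hp => ?_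
  · obtain ⟨a, b, c, d⟩ := hyps_of_mem_classPrimes_ivl hp
    exact h1 i hi p a b c d
  · obtain ⟨a, b, c, d⟩ := hyps_of_mem_classPrimes_ivl hp
    exact h2 i hi hi' p a b c d

end Summit.KontsevichZagierPeriods.Zeta5Search.Denom.TwoTaleP15Levels
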